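import Summits.AtomisticToContinuum.HydrodynamicLimit.Theorems.JParityClosureOddContactSymmetryMetroWeightContactInsert
import Summits.AtomisticToContinuum.HydrodynamicLimit.Theorems.JParityClosureOddContactSymmetryKdeWeightsContactInsert
import Summits.AtomisticToContinuum.HydrodynamicLimit.Theorems.JParityClosureOddContactSymmetryFluxOddBound
import Literature.MathematicalPhysics.QuantumManyBody.PeriodicBoseGasKineticMultiplierProofs
import HarnessLib

/-!
# The velocity-level Maxwell-defect bound at an inserted contact (line `KineticSlabSketch`, piece of P4)

Crux `JParityClosure.OddContactSymmetry` (stmt-AtomisticToContinuum-17722, rev 5), line `KineticSlabSketch`, lead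
`prover-line-stmt-AtomisticToContinuum-17722-c2-0` (cycle 3).  For fixed positions `xs`, a unit impact direction `ω` and an ordered pair
`(i, j)`, the flux-weighted Maxwellian mean over the velocities of the Metropolis acceptance defect of the crux's weight read on the
inserted contact configuration `contactInsert ε i j ω (zipConfig (xs, vs))` is at most `B(√ρ + ρ)` times the flux normalisation as
soon as the tagged occupancy `#{k | dist(x_k, x_j) < r/4}` exceeds `2 + 2/ρ` (`defectVel_le`): the weight is put in kernel form
(`stub_metroWeight_contactInsert`), its cone weights are velocity-free with off-pair mass `≥ (pmax/2)(count − 2)`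
(`stub_kdeWeights_contactInsert`), and the velocity-level bound K1 (hypothesis `hKB`, = `stub_kdeDefectPair` at `(θ, ϑ)`) applies.
-/

noncomputable section

open scoped BigOperators Classical InnerProductSpace ENNReal Topology
open Set MeasureTheory Filter Function
open Literature.Analysis.FluidPDE Literature.MathematicalPhysics.KineticTheory

namespace Summit.AtomisticToContinuum.HydrodynamicLimit.Theorems.OddContactSymmetryKineticSlab

/-- Positions of an inserted contact configuration do not depend on the velocities. [folklore] -/
theorem contactInsert_zipConfig_fst {N : ℕ} (ε : ℝ) (i j : Fin (N + 1)) (ω : V3) (xs : Fin (N + 1) → T3)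
    (vs vs' : Fin (N + 1) → V3) (k : Fin (N + 1)) :
    ((contactInsert ε i j ω (zipConfig (xs, vs))) k).1 = ((contactInsert ε i j ω (zipConfig (xs, vs'))) k).1 := by
  by_cases hk : k = i
  · subst hk
    simp [contactInsert_apply_self]
  · rw [contactInsert_apply_of_ne ε j ω _ hk, contactInsert_apply_of_ne ε j ω _ hk]
    simp

/-- **Velocity-level Maxwell-defect bound at an inserted contact.**  With `ε = hsDiameter σ N ≤ r/4`, `0 < σ < 1/2`, a unit
direction `ω`, positions `xs` whose tagged occupancy at `x_j` within `r/4` exceeds `2 + 2/ρ` (`0 < ρ ≤ 1`), and the K1 bound `hKB` at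
`(θ, ϑ)` with constant `B ≥ 0`:
`∫ We · (1 − w(contactInsert)) dγ^{⊗(N+1)} ≤ B(√ρ + ρ) · ∫ We dγ^{⊗(N+1)}`, `We = ofReal(ε²⟪ω, v_i − v_j⟫)`. [folklore] -/
theorem defectVel_le :
    ∀ {σ : ℝ} (_hσ : 0 < σ) (_hσ2 : σ < 1 / 2) {θ ϑ : ℝ} (_hθ : 0 < θ) (_hϑ : 0 < ϑ) {N : ℕ} {r : ℝ} (_hr : 0 < r)
    (_hεr : hsDiameter σ N ≤ r / 4) {i j : Fin (N + 1)} (_hij : i ≠ j) (ω : Metric.sphere (0 : V3) 1)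
    (xs : Fin (N + 1) → T3) {B : ℝ} (_hB0 : 0 ≤ B)
    (_hKB : ∀ {n : ℕ} {i j : Fin n} (_hij : i ≠ j) {p : Fin n → ℝ} {pmax : ℝ}
      (_hp0 : ∀ k, 0 ≤ p k) (_hpm : ∀ k, p k ≤ pmax) (_hP : 0 < ∑ k ∈ (Finset.univ \ {i, j}), p k) (ω : V3),
      ∫⁻ v, ENNReal.ofReal (max ⟪ω, v i - v j⟫_ℝ 0 *
          (1 - min 1 (Real.exp (-(
            Real.log (∑ k, p k * localMaxwellian 1 (ϑ ^ 2) (reflectVel ω (v i, v j)).1 (v k)) +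
            Real.log (∑ k, p k * localMaxwellian 1 (ϑ ^ 2) (reflectVel ω (v i, v j)).2 (v k)) -
            Real.log (∑ k, p k * localMaxwellian 1 (ϑ ^ 2) (v i) (v k)) -
            Real.log (∑ k, p k * localMaxwellian 1 (ϑ ^ 2) (v j) (v k)))))))
        ∂(Measure.pi fun _ : Fin n => gaussMeasure (0 : V3) θ) ≤
      ENNReal.ofReal (B * (Real.sqrt (pmax / ∑ k ∈ (Finset.univ \ {i, j}), p k) +
          pmax / ∑ k ∈ (Finset.univ \ {i, j}), p k)) *
        ∫⁻ v, ENNReal.ofReal (max ⟪ω, v i - v j⟫_ℝ 0) ∂(Measure.pi fun _ : Fin n => gaussMeasure (0 : V3) θ))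
    {ρ : ℝ} (_hρ0 : 0 < ρ) (_hρ1 : ρ ≤ 1)
    (_hcount : 2 + 2 / ρ < ((Finset.univ.filter fun k : Fin (N + 1) => Torus.euclidDist (xs k) (xs j) < r / 4).card : ℝ)),
    ∫⁻ vs, ENNReal.ofReal (hsDiameter σ N ^ 2 * ⟪((ω : V3)), vs i - vs j⟫_ℝ) *
        ENNReal.ofReal (1 - metroOddMark σ N (fun _ => 1) (fun _ => 1) (fun _ => 1) r ϑ 0
          (contactInsert (hsDiameter σ N) i j (ω : V3) (zipConfig (xs, vs))) i j)
        ∂(Measure.pi fun _ : Fin (N + 1) => gaussMeasure (0 : V3) θ) ≤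
      ENNReal.ofReal (B * (Real.sqrt ρ + ρ)) *
        ∫⁻ vs, ENNReal.ofReal (hsDiameter σ N ^ 2 * ⟪((ω : V3)), vs i - vs j⟫_ℝ)
          ∂(Measure.pi fun _ : Fin (N + 1) => gaussMeasure (0 : V3) θ) := by
  intro σ hσ hσ2 θ ϑ hθ hϑ N r hr hεr i j hij ω xs B hB0 hKB ρ hρ0 hρ1 hcount
  set ε : ℝ := hsDiameter σ N with hε
  have hε0 : 0 < ε := hsDiameter_pos hσ N
  have hε2 : ε < 1 / 2 := (hsDiameter_le hσ.le N).trans_lt hσ2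
  set μ : Measure (Fin (N + 1) → V3) := Measure.pi fun _ : Fin (N + 1) => gaussMeasure (0 : V3) θ with hμ
  -- velocity-free positions and kernel weights
  set w0 : Config (N + 1) (Fin 3) T3 := contactInsert ε i j (ω : V3) (zipConfig (xs, fun _ => (0 : V3))) with hw0
  set p : Fin (N + 1) → ℝ := fun k => ((N : ℝ) + 1)⁻¹ * (3 / (Real.pi * r ^ 3) *
    max (1 - Torus.euclidDist (w0 k).1 (w0 i).1 / r) 0) with hp
  set pmax : ℝ := ((N : ℝ) + 1)⁻¹ * (3 / (Real.pi * r ^ 3)) with hpmax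
  have hpos : ∀ (vs : Fin (N + 1) → V3) (k : Fin (N + 1)),
      ((contactInsert ε i j (ω : V3) (zipConfig (xs, vs))) k).1 = (w0 k).1 := fun vs k =>
    contactInsert_zipConfig_fst ε i j ω xs vs _ k
  -- weight facts (A2), transported to `p`
  obtain ⟨h0, hmax, hsum⟩ := stub_kdeWeights_contactInsert hε0 hε2 hr hεr hij ω xs (fun _ => (0 : V3))
  have hp0 : ∀ k, 0 ≤ p k := fun k => h0 k
  have hpm : ∀ k, p k ≤ pmax := fun k => hmax k
  have hpmax0 : 0 < pmax := by positivity
  set P : ℝ := ∑ k ∈ (Finset.univ \ {i, j}), p k with hP_def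
  have hPge : pmax / 2 * (((Finset.univ.filter fun k : Fin (N + 1) =>
      Torus.euclidDist (xs k) (xs j) < r / 4).card : ℝ) - 2) ≤ P := hsum
  have hcnt2 : 2 / ρ < ((Finset.univ.filter fun k : Fin (N + 1) =>
      Torus.euclidDist (xs k) (xs j) < r / 4).card : ℝ) - 2 := by linarith
  have hPpos : 0 < P := by
    have : 0 < pmax / 2 * (2 / ρ) := by positivity
    nlinarith
  have hratio : pmax / P ≤ ρ := by
    rw [div_le_iff₀ hPpos]
    have h1 : pmax / 2 * (2 / ρ) ≤ P := by nlinarith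
    have h2 : pmax / 2 * (2 / ρ) = pmax / ρ := by ring
    rw [h2, div_le_iff₀ hρ0] at h1
    linarith
  have hBle : B * (Real.sqrt (pmax / P) + pmax / P) ≤ B * (Real.sqrt ρ + ρ) :=
    mul_le_mul_of_nonneg_left (add_le_add (Real.sqrt_le_sqrt hratio) hratio) hB0
  -- K1 at the velocity-free weights
  have key := hKB hij hp0 hpm hPpos (ω : V3)
  -- rewrite the integrand: weight in kernel form (A1), velocity-free positions, flux factor
  have hW : ∀ vs : Fin (N + 1) → V3,
      ENNReal.ofReal (ε ^ 2 * ⟪((ω : V3)), vs i - vs j⟫_ℝ) *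
        ENNReal.ofReal (1 - metroOddMark σ N (fun _ => 1) (fun _ => 1) (fun _ => 1) r ϑ 0
          (contactInsert ε i j (ω : V3) (zipConfig (xs, vs))) i j) =
      ENNReal.ofReal (ε ^ 2) * ENNReal.ofReal (max ⟪((ω : V3)), vs i - vs j⟫_ℝ 0 *
          (1 - min 1 (Real.exp (-(
            Real.log (∑ k, p k * localMaxwellian 1 (ϑ ^ 2) (reflectVel (ω : V3) (vs i, vs j)).1 (vs k)) +
            Real.log (∑ k, p k * localMaxwellian 1 (ϑ ^ 2) (reflectVel (ω : V3) (vs i, vs j)).2 (vs k)) -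
            Real.log (∑ k, p k * localMaxwellian 1 (ϑ ^ 2) (vs i) (vs k)) -
            Real.log (∑ k, p k * localMaxwellian 1 (ϑ ^ 2) (vs j) (vs k))))))) := by
    intro vs
    rw [stub_metroWeight_contactInsert (σ := σ) hε0 hε2 r ϑ hij ω xs vs]
    simp only [hpos vs]
    have hnn : 0 ≤ 1 - min 1 (Real.exp (-(
        Real.log (∑ k, p k * localMaxwellian 1 (ϑ ^ 2) (reflectVel (ω : V3) (vs i, vs j)).1 (vs k)) +
        Real.log (∑ k, p k * localMaxwellian 1 (ϑ ^ 2) (reflectVel (ω : V3) (vs i, vs j)).2 (vs k)) -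
        Real.log (∑ k, p k * localMaxwellian 1 (ϑ ^ 2) (vs i) (vs k)) -
        Real.log (∑ k, p k * localMaxwellian 1 (ϑ ^ 2) (vs j) (vs k))))) := by
      have := min_le_left (1 : ℝ) (Real.exp (-(
        Real.log (∑ k, p k * localMaxwellian 1 (ϑ ^ 2) (reflectVel (ω : V3) (vs i, vs j)).1 (vs k)) +
        Real.log (∑ k, p k * localMaxwellian 1 (ϑ ^ 2) (reflectVel (ω : V3) (vs i, vs j)).2 (vs k)) -
        Real.log (∑ k, p k * localMaxwellian 1 (ϑ ^ 2) (vs i) (vs k)) -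
        Real.log (∑ k, p k * localMaxwellian 1 (ϑ ^ 2) (vs j) (vs k)))))
      linarith
    rw [ENNReal.ofReal_mul (sq_nonneg ε), Literature.MathematicalPhysics.QuantumManyBody.BoseGas.ofReal_eq_ofReal_max ⟪((ω : V3)), vs i - vs j⟫_ℝ, mul_assoc,
      ← ENNReal.ofReal_mul (le_max_right _ _)]
  have hW1 : ∀ vs : Fin (N + 1) → V3, ENNReal.ofReal (ε ^ 2 * ⟪((ω : V3)), vs i - vs j⟫_ℝ) =
      ENNReal.ofReal (ε ^ 2) * ENNReal.ofReal (max ⟪((ω : V3)), vs i - vs j⟫_ℝ 0) := fun vs => by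
    rw [ENNReal.ofReal_mul (sq_nonneg ε), Literature.MathematicalPhysics.QuantumManyBody.BoseGas.ofReal_eq_ofReal_max ⟪((ω : V3)), vs i - vs j⟫_ℝ]
  simp_rw [hW, hW1]
  rw [lintegral_const_mul' _ _ ENNReal.ofReal_ne_top, lintegral_const_mul' _ _ ENNReal.ofReal_ne_top]
  calc ENNReal.ofReal (ε ^ 2) * ∫⁻ vs, ENNReal.ofReal (max ⟪((ω : V3)), vs i - vs j⟫_ℝ 0 *
          (1 - min 1 (Real.exp (-(
            Real.log (∑ k, p k * localMaxwellian 1 (ϑ ^ 2) (reflectVel (ω : V3) (vs i, vs j)).1 (vs k)) +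
            Real.log (∑ k, p k * localMaxwellian 1 (ϑ ^ 2) (reflectVel (ω : V3) (vs i, vs j)).2 (vs k)) -
            Real.log (∑ k, p k * localMaxwellian 1 (ϑ ^ 2) (vs i) (vs k)) -
            Real.log (∑ k, p k * localMaxwellian 1 (ϑ ^ 2) (vs j) (vs k))))))) ∂μ
      ≤ ENNReal.ofReal (ε ^ 2) * (ENNReal.ofReal (B * (Real.sqrt (pmax / P) + pmax / P)) *
          ∫⁻ vs, ENNReal.ofReal (max ⟪((ω : V3)), vs i - vs j⟫_ℝ 0) ∂μ) := mul_le_mul' le_rfl key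
    _ ≤ ENNReal.ofReal (ε ^ 2) * (ENNReal.ofReal (B * (Real.sqrt ρ + ρ)) *
          ∫⁻ vs, ENNReal.ofReal (max ⟪((ω : V3)), vs i - vs j⟫_ℝ 0) ∂μ) :=
        mul_le_mul' le_rfl (mul_le_mul' (ENNReal.ofReal_le_ofReal hBle) le_rfl)
    _ = _ := by ring

end Summit.AtomisticToContinuum.HydrodynamicLimit.Theorems.OddContactSymmetryKineticSlab

end
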